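import Summits.QuantumFields.YangMills.Theorems.UnitScaleTiltProp7CornerCombCellTheorem
import HarnessLib

/-!
# Route `UnitScaleTilt`, crux K1 «MinimiserStabilityRegPr» (stmt-QuantumFields-19200), route-R E′ (A′)-on-Σ, P-A2 (β), row «(n3)-comb» —
# (O2) GROUNDWORK, file F-8b-4: THE CELL THEOREM IN MEMBER LETTERS — THE COMB TOWER'S LEVEL MASS OVER A PERIOD CELL, THE GAUGE ROW DISPLAYED

«(O2) groundwork — not consumed by any displayed row before the freeze lifts» (★★OWNER `ym3-torus-plan` g29∕g30 RULINGS №20 (2), №22 (c) «(II) GO»).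
Cell `ym3-torus`, width seat `ym-ust-19200-w5` (gen 8); pen F-8b «THE CELL THEOREM» (★routeR-w1 g9 PENS ROUND 5, 2026-08-29 10:02Z), file 4.  THEOREMS ONLY (0 `def`,
0 `sorry`); `--supports stmt-QuantumFields-19200 --as helper`, count-neutral.  YM₃ on T³ is a ladder rung (R3), not the Clay problem; nothing here claims `hMcomb`, (β),
`hPA2`, the stub, the crux, d = 4 or the mass gap.

THE POINT (SPEC F-8 §2, W1 organisation on `ℤᵈ`).  Data: `N′Lᵏ`-periodic unitary-valued `U₀`, `U₁` on `ℤᵈ`; the comb tower `Ỹ_j = Ũʲ − 1` (`Ũʲ = tildIter L U₀ U₁ j`), its source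
`rem_j = Ỹ_{j+1} − T_j(Ỹ_j)` (✓F-7a `tildTower_affine`), the SPLIT reduced families `G^{lin}` (sourceless, from `Ỹ_0`) and `N` (sourced, from `0`) and the gauge function `Λ` of
`G̃ = G^{lin} + N` at the corner charges `F̂^{Ūʲ}(·)(L•y)` (✓F-8b-1), the level windows as HYPOTHESES (unitarity of `Ūʲ`, `Ũʲ ∈ U1`, block loops `α_j ≤ 1∕24`, plaquettes `a_j`, two-block
sups `72μ_j ≤ 1`; geometric from the top in the scalar letters `θ′ θ_g θ₂`), and the scalar gauge row `hrow` of ✓F-7c-3 in the CELL letters `m n g lam` (the `√Σ` over the level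
cells `{boxVec (N′L^{k−j}) t}`) DISPLAYED — it is ★routeR-w6's F-6d-3 read through the DEF slot and the `ρ = (√L)⁻¹` dictionary (F-8b-5 ∕ F-8c-final).  CONCLUSION ★★★
`sum_cell_normSq_tild_le_two_slot`: for every `l ≤ k`,
`Σ_{t ∈ [0,N′L^{k−l})ᵈ} Σ_κ ‖Ũˡ(boxVec t, κ) − 1‖² ≤ 2·A²·(ρˡ)² + 2·B²·((ρ⁻¹)ˡ)²` with the closed letters `A`, `B` of ✓F-8b-3 `full_two_slot_of_rows` at `m 0 = √MASS₀(Ỹ₀)`,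
`g 0 = √GRAD₀^{U₀}(Ỹ₀)` — on `T³` `(ρˡ)² = L^{−l}`, `((ρ⁻¹)ˡ)² = Lˡ` (✓`rho_slots_T3`).  PROOF = inhabitation: periodicity of every level object (✓F-8a `isPeriodic_avgIter`∕
`isPeriodic_tildIter_le`, ✓F-8b-1 `isPeriodic_sourced_families`, §1 `rem_add_period`), the four rows of ✓F-8b-2 at coarse period `N′L^{k−(j+1)}` (cells transported along
`N′L^{k−(j+1)}·L = N′L^{k−j}`, `sum_boxVec_congr`), ✓F-7a `sourced_cornerComb_structure` for `y ≤ m + n + lam`, then ✓F-8b-3.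
HONEST SCOPE.  (`hcB0sq` keeps the top anchor `ρ^{2k}` — ★routeR-w1 g10's 11:26Z seam repair, adopted verbatim.)  Assembly only; `d` general with the two contraction letters `√(L²L⁻ᵈ) = ρ`, `√(L⁴L⁻ᵈ) = ρ⁻¹` as hypotheses (true at `d = 3`, ✓`rho_letters_T3`); every window is a
hypothesis; `𝔸` any non-trivial C⋆-algebra.

References: T. Bałaban, CMP **109** (1987) 249–301 [Balaban1987RG1] ((0.1), (0.4) pp.251–253); CMP **98** (1985) 17–51 [Balaban1985Averaging] ((2), (42)–(43), (68)–(69),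
Prop. 3 (122)–(126)); CMP **95** (1984) 17–40 [Balaban1984PropagatorsI] ((1.18)–(1.20)).
-/

set_option autoImplicit false

noncomputable section

open scoped BigOperators
open Finset

namespace Summit.QuantumFields.YangMills.Theorems.Prop7CornerCombCellTheoremMember

open NormedSpace
open Literature.MathematicalPhysics.QuantumFieldTheory.Balaban1983to89
open ExpMeanLog (eml)
open B7Prop1Explicit renaming Site → LSite
open B7Prop1Explicit (Letter e hol seg boxVec gammaWord plaqWord Wcx Xavg bavg expUnit U1)
open B7Prop2Explicit (avgIter unitaryUnits unitaryUnits_le_U1)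
open B7Eq92Concrete (tildIter)
open B7Eq78Linearization (conjR)
open B7Prop3GeneralRotated (tsum)
open B7Prop3GeneralLinear (FhatCov)
open B12Ineq417Flat (shiftCfg shiftCfg_apply)
open T4TermwiseTorus (IsPeriodic)
open Summit.QuantumFields.YangMills.Theorems.Prop7CombPeriodCellDict (shiftCfg_eq_of_isPeriodic isPeriodic_avgIter isPeriodic_tildIter_le)
open Summit.QuantumFields.YangMills.Theorems.Prop7CornerCombSourcedStructure (sourced_cornerComb_structure)
open Summit.QuantumFields.YangMills.Theorems.Prop7CornerCombFamiliesPeriodic (trueStep_shiftCfg smul_add_period isPeriodic_sourced_families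
  apply_add_period_of_isPeriodic period_tower_step exists_gauge_family cornerCharge_add sourced_recursion_of_split)
open Summit.QuantumFields.YangMills.Theorems.Prop7CornerCombLinesInhabited (sqrt_mass_lin_step_le sqrt_mass_sourced_step_le sqrt_grad_lin_step_le sqrt_mass_full_le)
open Summit.QuantumFields.YangMills.Theorems.Prop7CornerCombCellTheorem (full_two_slot_of_rows sq_two_slot_of_le)

variable {d : ℕ} {𝔸 : Type*} [CStarAlgebra 𝔸]

/-! ## §1 Bookkeeping: cells along the period tower, the source is periodic -/

omit [CStarAlgebra 𝔸] in
/-- Cell sums along equal periods agree (`Fin n` vs `Fin n′` for `n = n′`). [folklore] -/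
theorem sum_boxVec_congr {M : Type*} [AddCommMonoid M] {n n' : ℕ} (h : n = n') (f : LSite d → M) :
    ∑ t : Fin d → Fin n, f (boxVec n t) = ∑ t : Fin d → Fin n', f (boxVec n' t) := by
  subst h; rfl

/-- **THE SOURCE OF THE COMB TOWER IS PERIODIC**: for `N′L`-periodic `V`, `Y` and `N′`-periodic `Y′`, `rem(z,κ) = Y′(z,κ) − T_V(Y)(L•z,κ)` is `N′`-periodic (✓F-8b-1 `trueStep_shiftCfg`).
[cite: Balaban1987RG1, (0.1) p.251; Balaban1985Averaging, (68)–(69) p.29] -/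
theorem rem_isPeriodic (L N N' : ℕ) (hN : N = N' * L) (V : LSite d → Fin d → 𝔸ˣ) (hV : IsPeriodic N V) (Y Y' : LSite d → Fin d → 𝔸)
    (hY : IsPeriodic N Y) (hY' : IsPeriodic N' Y') (rem : LSite d → Fin d → 𝔸)
    (hrem : ∀ (z : LSite d) (κ : Fin d), rem z κ = Y' z κ
      - (fderiv ℂ (eml : ((Fin d → Fin L) → 𝔸) → 𝔸) (fun r => ((Wcx L V ((L : ℤ) • z) κ (boxVec L r) : 𝔸ˣ) : 𝔸))
            (fun r => tsum V Y ((L : ℤ) • z) (gammaWord L κ (boxVec L r) ++ seg κ (-(L : ℤ))) * ((Wcx L V ((L : ℤ) • z) κ (boxVec L r) : 𝔸ˣ) : 𝔸))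
            * (((expUnit (Xavg L V ((L : ℤ) • z) κ))⁻¹ : 𝔸ˣ) : 𝔸)
          + ((expUnit (Xavg L V ((L : ℤ) • z) κ) : 𝔸ˣ) : 𝔸) * tsum V Y ((L : ℤ) • z) (seg κ (L : ℤ)) * (((expUnit (Xavg L V ((L : ℤ) • z) κ))⁻¹ : 𝔸ˣ) : 𝔸))) :
    IsPeriodic N' rem := by
  intro x m
  funext κ
  have hVs := shiftCfg_eq_of_isPeriodic hV m
  have hYs := shiftCfg_eq_of_isPeriodic hY m
  rw [hrem, hrem, smul_add_period L N N' hN x m, ← trueStep_shiftCfg L ((N : ℤ) • m) V Y ((L : ℤ) • x) κ, hVs, hYs, hY' x m]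

/-- `Ỹ_j = Ũʲ − 1` is `N′L^{k−j}`-periodic for `N′Lᵏ`-periodic data (✓F-8a `isPeriodic_tildIter_le`). [cite: Balaban1985Averaging, (69) p.29] -/
theorem tildField_isPeriodic (L N' k : ℕ) {U₀ U₁ : LSite d → Fin d → 𝔸ˣ} (hU₀ : IsPeriodic (N' * L ^ k) U₀) (hU₁ : IsPeriodic (N' * L ^ k) U₁)
    (Yt : ℕ → LSite d → Fin d → 𝔸) (hYt : ∀ (i : ℕ) (x : LSite d) (μ : Fin d), Yt i x μ = ((tildIter L U₀ U₁ i x μ : 𝔸ˣ) : 𝔸) - 1)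
    {j : ℕ} (hj : j ≤ k) : IsPeriodic (N' * L ^ (k - j)) (Yt j) := by
  intro x m'
  funext μ
  rw [hYt, hYt, isPeriodic_tildIter_le L N' k hU₀ hU₁ hj x m']

/-- `Ūʲ` is `N′L^{k−j}`-periodic for `N′Lᵏ`-periodic `U₀` (✓F-8a `isPeriodic_avgIter`). [cite: Balaban1985Averaging, (43) p.24] -/
theorem avgIter_isPeriodic_level (L N' k : ℕ) {U₀ : LSite d → Fin d → 𝔸ˣ} (hU₀ : IsPeriodic (N' * L ^ k) U₀) {j : ℕ} (hj : j ≤ k) :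
    IsPeriodic (N' * L ^ (k - j)) (avgIter L U₀ j) := by
  refine isPeriodic_avgIter L (N' * L ^ (k - j)) j ?_
  rwa [mul_assoc, ← pow_add, Nat.sub_add_cancel hj]

/-! ## §2 ★★★ The cell theorem in member letters (the gauge row displayed) -/

variable [Nontrivial 𝔸]

/-- ★★★ **THE COMB TOWER'S LEVEL MASS OVER A PERIOD CELL, TWO SLOTS** (SPEC F-8 §2; the scalar gauge row DISPLAYED as `hrow`).  See the module docstring for the data; the
letters `m n g y lam` are the cell `√Σ`'s of `G^{lin}`, `N`, `G^{lin}`'s covariant gradient, `Ỹ`, and `Λ`'s covariant gradient over the level cells `{boxVec (N′L^{k−j}) t}`.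
CONCLUSION: for every `l ≤ k`, `Σ_{t,κ} ‖Ũˡ(boxVec (N′L^{k−l}) t, κ) − 1‖² ≤ 2·A²·(ρˡ)² + 2·B²·((ρ⁻¹)ˡ)²`, `A`, `B` the closed letters of ✓F-8b-3 `full_two_slot_of_rows`.
[cite: Balaban1987RG1, (0.1), (0.4) pp.251–253; Balaban1985Averaging, Prop. 3 (122)–(126) p.36, (68)–(69) p.29] -/
theorem sum_cell_normSq_tild_le_two_slot (L N' k : ℕ) (hL : 1 ≤ L) (hN' : 0 < N') (U₀ U₁ : LSite d → Fin d → 𝔸ˣ)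
    (hU₀ : IsPeriodic (N' * L ^ k) U₀) (hU₁ : IsPeriodic (N' * L ^ k) U₁)
    (hVu : ∀ j ≤ k, ∀ x μ, avgIter L U₀ j x μ ∈ unitaryUnits 𝔸) (hTu : ∀ j < k, ∀ x μ, tildIter L U₀ U₁ j x μ ∈ U1 𝔸)
    (α a μ : ℕ → ℝ) (hα0 : ∀ j, 0 ≤ α j) (hα24 : ∀ j < k, α j ≤ 1 / 24)
    (hα : ∀ j < k, ∀ (z : LSite d) (κ : Fin d) (r : Fin d → Fin L), ‖((Wcx L (avgIter L U₀ j) ((L : ℤ) • z) κ (boxVec L r) : 𝔸ˣ) : 𝔸) - 1‖ ≤ α j)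
    (ha0 : ∀ j, 0 ≤ a j) (hplaq : ∀ j < k, ∀ (x : LSite d) (κ' μ' : Fin d), κ' ≠ μ' → ‖((hol (avgIter L U₀ j) x (plaqWord κ' μ') : 𝔸ˣ) : 𝔸) - 1‖ ≤ a j)
    (hμ0 : ∀ j, 0 ≤ μ j) (hμ72 : ∀ j < k, 72 * μ j ≤ 1)
    (Yt : ℕ → LSite d → Fin d → 𝔸) (hYt : ∀ (i : ℕ) (x : LSite d) (μ' : Fin d), Yt i x μ' = ((tildIter L U₀ U₁ i x μ' : 𝔸ˣ) : 𝔸) - 1)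
    (hμ : ∀ j < k, ∀ (z : Fin d → Fin (N' * L ^ (k - (j + 1)))) (κ : Fin d), (2 * d + 2) * L * Real.sqrt (∑ s : Fin d → Fin L, ∑ ν : Fin d,
      (‖Yt j ((L : ℤ) • boxVec (N' * L ^ (k - (j + 1))) z + boxVec L s) ν‖ ^ 2
        + ‖Yt j ((L : ℤ) • boxVec (N' * L ^ (k - (j + 1))) z + (L : ℤ) • e κ + boxVec L s) ν‖ ^ 2)) ≤ μ j)
    (Glin Nn rem : ℕ → LSite d → Fin d → 𝔸) (Λ : ℕ → LSite d → 𝔸)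
    (hrem : ∀ (j : ℕ) (z : LSite d) (κ : Fin d), rem j z κ = Yt (j + 1) z κ
      - (fderiv ℂ (eml : ((Fin d → Fin L) → 𝔸) → 𝔸) (fun r => ((Wcx L (avgIter L U₀ j) ((L : ℤ) • z) κ (boxVec L r) : 𝔸ˣ) : 𝔸))
            (fun r => tsum (avgIter L U₀ j) (Yt j) ((L : ℤ) • z) (gammaWord L κ (boxVec L r) ++ seg κ (-(L : ℤ)))
              * ((Wcx L (avgIter L U₀ j) ((L : ℤ) • z) κ (boxVec L r) : 𝔸ˣ) : 𝔸))
            * (((expUnit (Xavg L (avgIter L U₀ j) ((L : ℤ) • z) κ))⁻¹ : 𝔸ˣ) : 𝔸)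
          + ((expUnit (Xavg L (avgIter L U₀ j) ((L : ℤ) • z) κ) : 𝔸ˣ) : 𝔸) * tsum (avgIter L U₀ j) (Yt j) ((L : ℤ) • z) (seg κ (L : ℤ))
            * (((expUnit (Xavg L (avgIter L U₀ j) ((L : ℤ) • z) κ))⁻¹ : 𝔸ˣ) : 𝔸)))
    (hG0 : Glin 0 = Yt 0) (hN0 : Nn 0 = 0) (hΛ0 : ∀ z, Λ 0 z = 0)
    (hGlin : ∀ (j : ℕ) (z : LSite d) (κ : Fin d), Glin (j + 1) z κ
      = (fderiv ℂ (eml : ((Fin d → Fin L) → 𝔸) → 𝔸) (fun r => ((Wcx L (avgIter L U₀ j) ((L : ℤ) • z) κ (boxVec L r) : 𝔸ˣ) : 𝔸))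
            (fun r => tsum (avgIter L U₀ j) (Glin j) ((L : ℤ) • z) (gammaWord L κ (boxVec L r) ++ seg κ (-(L : ℤ)))
              * ((Wcx L (avgIter L U₀ j) ((L : ℤ) • z) κ (boxVec L r) : 𝔸ˣ) : 𝔸))
            * (((expUnit (Xavg L (avgIter L U₀ j) ((L : ℤ) • z) κ))⁻¹ : 𝔸ˣ) : 𝔸)
          + ((expUnit (Xavg L (avgIter L U₀ j) ((L : ℤ) • z) κ) : 𝔸ˣ) : 𝔸) * tsum (avgIter L U₀ j) (Glin j) ((L : ℤ) • z) (seg κ (L : ℤ))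
            * (((expUnit (Xavg L (avgIter L U₀ j) ((L : ℤ) • z) κ))⁻¹ : 𝔸ˣ) : 𝔸))
        - (FhatCov L (avgIter L U₀ j) (Glin j) ((L : ℤ) • z) - conjR (avgIter L U₀ (j + 1) z κ) (FhatCov L (avgIter L U₀ j) (Glin j) ((L : ℤ) • (z + e κ)))))
    (hNn : ∀ (j : ℕ) (z : LSite d) (κ : Fin d), Nn (j + 1) z κ
      = (fderiv ℂ (eml : ((Fin d → Fin L) → 𝔸) → 𝔸) (fun r => ((Wcx L (avgIter L U₀ j) ((L : ℤ) • z) κ (boxVec L r) : 𝔸ˣ) : 𝔸))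
            (fun r => tsum (avgIter L U₀ j) (Nn j) ((L : ℤ) • z) (gammaWord L κ (boxVec L r) ++ seg κ (-(L : ℤ)))
              * ((Wcx L (avgIter L U₀ j) ((L : ℤ) • z) κ (boxVec L r) : 𝔸ˣ) : 𝔸))
            * (((expUnit (Xavg L (avgIter L U₀ j) ((L : ℤ) • z) κ))⁻¹ : 𝔸ˣ) : 𝔸)
          + ((expUnit (Xavg L (avgIter L U₀ j) ((L : ℤ) • z) κ) : 𝔸ˣ) : 𝔸) * tsum (avgIter L U₀ j) (Nn j) ((L : ℤ) • z) (seg κ (L : ℤ))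
            * (((expUnit (Xavg L (avgIter L U₀ j) ((L : ℤ) • z) κ))⁻¹ : 𝔸ˣ) : 𝔸))
        - (FhatCov L (avgIter L U₀ j) (Nn j) ((L : ℤ) • z) - conjR (avgIter L U₀ (j + 1) z κ) (FhatCov L (avgIter L U₀ j) (Nn j) ((L : ℤ) • (z + e κ))))
        + rem j z κ)
    (hΛs : ∀ (j : ℕ) (z : LSite d), Λ (j + 1) z = FhatCov L (avgIter L U₀ j) (Glin j + Nn j) ((L : ℤ) • z) + Λ j ((L : ℤ) • z))
    (m n g y lam : ℕ → ℝ)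
    (hm : ∀ j, m j = Real.sqrt (∑ t : Fin d → Fin (N' * L ^ (k - j)), ∑ μ' : Fin d, ‖Glin j (boxVec (N' * L ^ (k - j)) t) μ'‖ ^ 2))
    (hn : ∀ j, n j = Real.sqrt (∑ t : Fin d → Fin (N' * L ^ (k - j)), ∑ μ' : Fin d, ‖Nn j (boxVec (N' * L ^ (k - j)) t) μ'‖ ^ 2))
    (hy : ∀ j, y j = Real.sqrt (∑ t : Fin d → Fin (N' * L ^ (k - j)), ∑ μ' : Fin d, ‖Yt j (boxVec (N' * L ^ (k - j)) t) μ'‖ ^ 2))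
    (hg : ∀ j, g j = Real.sqrt (∑ t : Fin d → Fin (N' * L ^ (k - j)), ∑ κ : Fin d, ∑ ν : Fin d,
      ‖conjR (avgIter L U₀ j (boxVec (N' * L ^ (k - j)) t) ν) (Glin j (boxVec (N' * L ^ (k - j)) t + e ν) κ) - Glin j (boxVec (N' * L ^ (k - j)) t) κ‖ ^ 2))
    (hlam : ∀ j, lam j = Real.sqrt (∑ t : Fin d → Fin (N' * L ^ (k - j)), ∑ κ : Fin d,
      ‖Λ j (boxVec (N' * L ^ (k - j)) t) - conjR (avgIter L U₀ j (boxVec (N' * L ^ (k - j)) t) κ) (Λ j (boxVec (N' * L ^ (k - j)) t + e κ))‖ ^ 2))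
    {ρ θ' θg θ₂ ΘM wG wN wS cA cB0 cB1 : ℝ} (hρ0 : 0 < ρ) (hρ1 : ρ < 1)
    (hρm : Real.sqrt ((L : ℝ) ^ 2 * ((L : ℝ) ^ d)⁻¹) = ρ) (hρg : Real.sqrt ((L : ℝ) ^ 4 * ((L : ℝ) ^ d)⁻¹) = ρ⁻¹)
    (hθ' : 0 ≤ θ') (hθg : 0 ≤ θg) (hθ₂ : 0 ≤ θ₂) (hΘM : 0 ≤ ΘM) (hwG : 0 ≤ wG) (hwN : 0 ≤ wN) (hwS : 0 ≤ wS) (hcA : 0 ≤ cA) (hcB0 : 0 ≤ cB0)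
    (hcB1 : 0 ≤ cB1) (wM : ℕ → ℝ) (hwM0 : ∀ j, 0 ≤ wM j) (hwMgeo : ∀ j < k, wM j ≤ ΘM * ρ ^ (4 * (k - j)))
    (hκgeo : ∀ j < k, 210 * ((2 * d + 2) * L) * α j * Real.sqrt (2 * d) ≤ θ' * ρ ^ (4 * (k - j)))
    (hKgeo : ∀ j < k, (24 * α j + 8 * (((d : ℝ) + 2) * L) ^ 2 * a j) * Real.sqrt (d * ((L : ℝ) ^ 2 * ((L : ℝ) ^ d)⁻¹))
      + 210 * ((2 * d + 2) * L) * α j * Real.sqrt (8 * (d : ℝ) ^ 2) ≤ θg * ρ ^ (4 * (k - j)))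
    (hσgeo : ∀ j < k, 260 * μ j * ((2 * d + 2) * L) * Real.sqrt (2 * d) ≤ θ₂ * ρ ^ (2 * (k - j)))
    (hrow : ∀ j ≤ k, lam j ^ 2 ≤ ∑ i ∈ Finset.range j, (ρ⁻¹) ^ (j - i) * (wG * g i ^ 2 + wN * n i ^ 2 + wM i * (m i ^ 2 + n i ^ 2)
      + wS * (260 * μ i * ((2 * d + 2) * L) * Real.sqrt (2 * d)) ^ 2 * (m i + n i + lam i) ^ 2))
    (hsmall : Real.exp (θ' * (ρ ^ 3 / (1 - ρ ^ 4))) * θ₂ * (1 + cB1) * (ρ ^ 3 / (1 - ρ ^ 4)) ≤ 1 / 2)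
    (hsmallS : 12 * wS * θ₂ ^ 2 * (ρ / (1 - ρ)) ≤ 1 / 2)
    (hcB0sq : 2 * wG * (g 0 + θg * Real.exp (θ' * (ρ ^ 3 / (1 - ρ ^ 4))) * m 0 * ρ ^ (2 * k) * (ρ ^ 3 / (1 - ρ ^ 2))) ^ 2 * (ρ / (1 - ρ)) ≤ cB0 ^ 2)
    (hcB1sq : 2 * (wN * (ρ / (1 - ρ)) + (ΘM + 3 * wS * θ₂ ^ 2) * (ρ ^ 5 / (1 - ρ ^ 5))) ≤ cB1 ^ 2)
    (hcAsq : 2 * ((ΘM + 3 * wS * θ₂ ^ 2) * (Real.exp (θ' * (ρ ^ 3 / (1 - ρ ^ 4))) * m 0) ^ 2) * (ρ / (1 - ρ)) ≤ cA ^ 2) :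
    ∀ l ≤ k, ∑ t : Fin d → Fin (N' * L ^ (k - l)), ∑ κ : Fin d, ‖((tildIter L U₀ U₁ l (boxVec (N' * L ^ (k - l)) t) κ : 𝔸ˣ) : 𝔸) - 1‖ ^ 2
      ≤ 2 * ((Real.exp (θ' * (ρ ^ 3 / (1 - ρ ^ 4))) * m 0
              + 2 * Real.exp (θ' * (ρ ^ 3 / (1 - ρ ^ 4))) * θ₂ * (Real.exp (θ' * (ρ ^ 3 / (1 - ρ ^ 4))) * m 0 + cA) * (ρ / (1 - ρ ^ 2))
              + (cA + cB1 * (2 * Real.exp (θ' * (ρ ^ 3 / (1 - ρ ^ 4))) * θ₂ * (Real.exp (θ' * (ρ ^ 3 / (1 - ρ ^ 4))) * m 0 + cA) * (ρ / (1 - ρ ^ 2))))) ^ 2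
            * (ρ ^ l) ^ 2)
        + 2 * ((2 * Real.exp (θ' * (ρ ^ 3 / (1 - ρ ^ 4))) * θ₂ * cB0 * (ρ ^ 3 / (1 - ρ ^ 4))
            + (cB0 + cB1 * (2 * Real.exp (θ' * (ρ ^ 3 / (1 - ρ ^ 4))) * θ₂ * cB0 * (ρ ^ 3 / (1 - ρ ^ 4))))) ^ 2 * ((ρ⁻¹) ^ l) ^ 2) := by
  -- periods
  set Nc : ℕ → ℕ := fun j => N' * L ^ (k - j) with hNc
  have hL0 : 0 < L := hL
  have hNc0 : ∀ j, 0 < Nc j := fun j => by simp only [hNc]; positivity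
  have hNcs : ∀ j < k, Nc j = Nc (j + 1) * L := fun j hj => by simp only [hNc]; exact period_tower_step N' L k j hj
  -- periodicity of the level objects
  have hVper : ∀ j ≤ k, IsPeriodic (Nc j) (avgIter L U₀ j) := fun j hj => avgIter_isPeriodic_level L N' k hU₀ hj
  have hYper : ∀ j ≤ k, IsPeriodic (Nc j) (Yt j) := fun j hj => tildField_isPeriodic L N' k hU₀ hU₁ Yt hYt hj
  have hremper : ∀ j < k, IsPeriodic (Nc (j + 1)) (rem j) := fun j hj =>
    rem_isPeriodic L (Nc j) (Nc (j + 1)) (hNcs j hj) (avgIter L U₀ j) (hVper j hj.le) (Yt j) (Yt (j + 1)) (hYper j hj.le) (hYper (j + 1) hj) (rem j)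
      (hrem j)
  have hY0per : IsPeriodic (Nc 0) (Yt 0) := hYper 0 (Nat.zero_le _)
  -- the three families are periodic (✓F-8b-1)
  have hCM : ∀ (j : ℕ) (X X' : LSite d → Fin d → 𝔸) (y : LSite d),
      (fun (j : ℕ) (X : LSite d → Fin d → 𝔸) (y : LSite d) => FhatCov L (avgIter L U₀ j) X ((L : ℤ) • y)) j (X + X') y
        = (fun (j : ℕ) (X : LSite d → Fin d → 𝔸) (y : LSite d) => FhatCov L (avgIter L U₀ j) X ((L : ℤ) • y)) j X y
          + (fun (j : ℕ) (X : LSite d → Fin d → 𝔸) (y : LSite d) => FhatCov L (avgIter L U₀ j) X ((L : ℤ) • y)) j X' y :=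
    fun j X X' y => cornerCharge_add L U₀ j X X' y
  have hGt := sourced_recursion_of_split L U₀ (fun j X y => FhatCov L (avgIter L U₀ j) X ((L : ℤ) • y)) hCM rem Glin Nn hGlin hNn
  have hGtper : ∀ j ≤ k, IsPeriodic (Nc j) (Glin j + Nn j) ∧ IsPeriodic (Nc j) (Λ j) := by
    refine isPeriodic_sourced_families L Nc k hNcs (fun j => avgIter L U₀ j) hVper rem hremper (fun j => Glin j + Nn j) Λ ?_ hΛ0
      (fun j z κ => hGt j z κ) hΛs
    show IsPeriodic (Nc 0) (Glin 0 + Nn 0)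
    rw [hG0, hN0, add_zero]; exact hY0per
  obtain ⟨Λl, hΛl0, hΛls⟩ := exists_gauge_family L (fun j X y => FhatCov L (avgIter L U₀ j) X ((L : ℤ) • y)) Glin
  have hGlper : ∀ j ≤ k, IsPeriodic (Nc j) (Glin j) := fun j hj =>
    (isPeriodic_sourced_families L Nc k hNcs (fun j => avgIter L U₀ j) hVper (fun _ _ _ => 0) (fun _ _ _ _ => rfl) Glin Λl
      (by rw [hG0]; exact hY0per) hΛl0 (fun j z κ => by rw [hGlin, add_zero]) hΛls j hj).1
  have hNper : ∀ j ≤ k, IsPeriodic (Nc j) (Nn j) := fun j hj => by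
    have h1 := (hGtper j hj).1
    have h2 := hGlper j hj
    intro x m'
    have := h1 x m'
    rw [Pi.add_apply, Pi.add_apply, h2 x m'] at this
    exact add_left_cancel this
  -- the structure identity (✓F-7a) below the unit loop window
  have hW : ∀ j < k, ∀ (z : LSite d) (κ : Fin d) (r : Fin d → Fin L), ‖((Wcx L (avgIter L U₀ j) ((L : ℤ) • z) κ (boxVec L r) : 𝔸ˣ) : 𝔸) - 1‖ < 1 :=
    fun j hj z κ r => (hα j hj z κ r).trans_lt (by linarith [hα24 j hj])
  have hstruct := sourced_cornerComb_structure L U₀ k hW Yt rem (fun j z κ => by rw [hrem]; abel)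
    (fun j X y => FhatCov L (avgIter L U₀ j) X ((L : ℤ) • y)) (fun j => Glin j + Nn j) Λ (by funext z κ; rw [Pi.add_apply, hG0, hN0]; simp) hΛ0
    (fun j z κ => hGt j z κ) hΛs
  -- nonnegativity of the letters
  have hm0' : ∀ j, 0 ≤ m j := fun j => by rw [hm]; exact Real.sqrt_nonneg _
  have hn0' : ∀ j, 0 ≤ n j := fun j => by rw [hn]; exact Real.sqrt_nonneg _
  have hg0' : ∀ j, 0 ≤ g j := fun j => by rw [hg]; exact Real.sqrt_nonneg _
  have hy0' : ∀ j, 0 ≤ y j := fun j => by rw [hy]; exact Real.sqrt_nonneg _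
  have hlam0 : ∀ j, 0 ≤ lam j := fun j => by rw [hlam]; exact Real.sqrt_nonneg _
  have hn00 : n 0 = 0 := by rw [hn, hN0]; simp
  -- coordinate periodicity at the fine period `Nc (j+1) * L`
  have hcoord : ∀ {X : LSite d → Fin d → 𝔸} {j : ℕ}, j < k → IsPeriodic (Nc j) X →
      ∀ (x : LSite d) (κ μ' : Fin d), X (x + ((Nc (j + 1) * L : ℕ) : ℤ) • e κ) μ' = X x μ' := by
    intro X j hj hX x κ μ'
    rw [← hNcs j hj]; exact apply_add_period_of_isPeriodic hX x κ μ'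
  have hcoordU : ∀ {j : ℕ}, j < k → ∀ (x : LSite d) (κ μ' : Fin d),
      avgIter L U₀ j (x + ((Nc (j + 1) * L : ℕ) : ℤ) • e κ) μ' = avgIter L U₀ j x μ' := by
    intro j hj x κ μ'
    rw [← hNcs j hj]; exact apply_add_period_of_isPeriodic (hVper j hj.le) x κ μ'
  -- ★ the four rows, level by level
  have hmrec : ∀ j < k, m (j + 1) ≤ (ρ + 210 * ((2 * d + 2) * L) * α j * Real.sqrt (2 * d)) * m j := by
    intro j hj
    haveI : NeZero (Nc (j + 1)) := ⟨(hNc0 (j + 1)).ne'⟩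
    have h := sqrt_mass_lin_step_le L (Nc (j + 1)) hL U₀ j (hVu j hj.le) (Glin j) (Glin (j + 1)) (hcoord hj (hGlper j hj.le)) (hα0 j) (hα24 j hj)
      (fun z κ r => hα j hj _ κ r) (hGlin j)
    rw [hρm, sum_boxVec_congr (hNcs j hj).symm (fun x => ∑ ν : Fin d, ‖Glin j x ν‖ ^ 2)] at h
    rw [hm, hm]; exact h
  have hnrec : ∀ j < k, n (j + 1) ≤ (ρ + 210 * ((2 * d + 2) * L) * α j * Real.sqrt (2 * d)) * n j
      + 260 * μ j * ((2 * d + 2) * L) * Real.sqrt (2 * d) * y j := by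
    intro j hj
    haveI : NeZero (Nc (j + 1)) := ⟨(hNc0 (j + 1)).ne'⟩
    have h := sqrt_mass_sourced_step_le L (Nc (j + 1)) hL U₀ U₁ j (hVu j hj.le) (hTu j hj) Yt hYt (Nn j) (Nn (j + 1)) (hcoord hj (hNper j hj.le))
      (hcoord hj (hYper j hj.le)) (hα0 j) (hα24 j hj) (fun z κ r => hα j hj _ κ r) (hμ0 j) (hμ72 j hj) (hμ j hj) (rem j) (hrem j) (hNn j)
    rw [hρm, sum_boxVec_congr (hNcs j hj).symm (fun x => ∑ ν : Fin d, ‖Nn j x ν‖ ^ 2),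
      sum_boxVec_congr (hNcs j hj).symm (fun x => ∑ ν : Fin d, ‖Yt j x ν‖ ^ 2)] at h
    rw [hn, hn, hy]; exact h
  have hgrec : ∀ j < k, g (j + 1) ≤ ρ⁻¹ * g j + ((24 * α j + 8 * (((d : ℝ) + 2) * L) ^ 2 * a j) * Real.sqrt (d * ((L : ℝ) ^ 2 * ((L : ℝ) ^ d)⁻¹))
      + 210 * ((2 * d + 2) * L) * α j * Real.sqrt (8 * (d : ℝ) ^ 2)) * m j := by
    intro j hj
    haveI : NeZero (Nc (j + 1)) := ⟨(hNc0 (j + 1)).ne'⟩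
    have h := sqrt_grad_lin_step_le L (Nc (j + 1)) hL U₀ j (hVu j hj.le) (hcoordU hj) (ha0 j) (hplaq j hj) (hα0 j) (hα24 j hj) (hα j hj)
      (Glin j) (Glin (j + 1)) (hcoord hj (hGlper j hj.le)) (hGlin j)
    rw [hρg, sum_boxVec_congr (hNcs j hj).symm (fun x => ∑ κ : Fin d, ∑ ν : Fin d, ‖conjR (avgIter L U₀ j x ν) (Glin j (x + e ν) κ) - Glin j x κ‖ ^ 2),
      sum_boxVec_congr (hNcs j hj).symm (fun x => ∑ ν : Fin d, ‖Glin j x ν‖ ^ 2)] at h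
    rw [hg, hg, hm]; exact h
  have hyle : ∀ j ≤ k, y j ≤ m j + n j + lam j := by
    intro j hj
    have h := sqrt_mass_full_le (Nc j) (avgIter L U₀ j) (Yt j) (Glin j) (Nn j) (Λ j) (fun z κ => by
      have := hstruct j hj z κ; rw [Pi.add_apply] at this; exact this)
    rw [hy, hm, hn, hlam]; exact h
  -- ★ the scalar top knit (✓F-8b-3)
  have hts := full_two_slot_of_rows hρ0 hρ1 hθ' hθg hθ₂ hΘM hwG hwN hwS hcA hcB0 hcB1
    (fun j => 210 * ((2 * d + 2) * L) * α j * Real.sqrt (2 * d))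
    (fun j => (24 * α j + 8 * (((d : ℝ) + 2) * L) ^ 2 * a j) * Real.sqrt (d * ((L : ℝ) ^ 2 * ((L : ℝ) ^ d)⁻¹)) + 210 * ((2 * d + 2) * L) * α j * Real.sqrt (8 * (d : ℝ) ^ 2))
    (fun j => 260 * μ j * ((2 * d + 2) * L) * Real.sqrt (2 * d)) m n g y lam wM
    (fun j => by have := hα0 j; positivity) (fun j => by have := hα0 j; have := ha0 j; positivity) (fun j => by have := hμ0 j; positivity)
    hm0' hn0' hg0' hlam0 hwM0 hκgeo hKgeo hσgeo hwMgeo hmrec hgrec hn00 hnrec hyle hrow hsmall hsmallS hcB0sq hcB1sq hcAsq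
  intro l hl
  have h2 := sq_two_slot_of_le (hy0' l) (hts l hl)
  have hyl : y l ^ 2 = ∑ t : Fin d → Fin (N' * L ^ (k - l)), ∑ κ : Fin d, ‖((tildIter L U₀ U₁ l (boxVec (N' * L ^ (k - l)) t) κ : 𝔸ˣ) : 𝔸) - 1‖ ^ 2 := by
    rw [hy, Real.sq_sqrt (by positivity)]
    simp_rw [hYt]
  rw [hyl] at h2
  exact h2

end Summit.QuantumFields.YangMills.Theorems.Prop7CornerCombCellTheoremMember

end
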